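import Mathlib
import Summits.Ventures.PercRepro2.V2SP
import Summits.Ventures.PercRepro2.Tail2DPathFlip
import Summits.Ventures.PercRepro2.Tail2DPathAvg
import Summits.Ventures.PercRepro2.Tail2DTailAvg

/-!
# The tail-average monotonicity linearises: the masked antipodal sums
(seat mine-b, cell pub-perc-repro2; MINE-B.md §40.3–40.4)

For a pattern `s` and a mask `m : s.Conf`, `x ⊕ m` flips the free edges selected by `m` (`xorConf`).  The
tail-average monotonicity `(T-AVG)(a,c)`: `P(a,c)·T(a−1,c+1) ≤ P(a−1,c+1)·T(a,c)` is the double sum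
`Σ_{x ∈ E, y ∈ E′} (π_x − π_y) ≤ 0` over the tail `E = {r ≥ a, b ≥ c}` and the bluer tail `E′ = {r ≥ a−1, b ≥ c+1}`;
grouping the pairs `(x, y)` by the mask `m = x ⊕ y` gives the EXACT identity

  `P(a,c)·T(a−1,c+1) − P(a−1,c+1)·T(a,c) = Σ_m CC_m(a,c)`,   `CC_m(a,c) = Σ_x [x ∈ E][x ⊕ m ∈ E′] (π_x − π_{x⊕m})`

(`tailAvg_of_maskCC`).  Each `CC_m` is LINEAR in the configuration data `(r, b, π)` of `x` and of `x ⊕ m` — the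
antipodal profile — and the natural family containing it is the masked four-parameter tail sum
`maskD s m α γ α' γ' = Σ_{r ≥ α, b ≥ γ, r̄ ≥ α', b̄ ≥ γ'} (π − π̄)` (`CC_m(a,c) = maskD s m a c (a−1) (c+1)`).  In this file:
the involution (`maskD_swap`: `maskD s m α γ α' γ' = −maskD s m α' γ' α γ`), the SERIES step (`maskD_ser`: the masked
4-tail of a series composition is the product of the factors' and `π` multiplies — a product of two inequalities),
the PARALLEL fibre formula (`maskD_par`), the atoms on the census region `α' < α ∧ α + γ ≤ α' + γ'`
(0 violations on every pattern ≤ 7 atoms over free / red-pin / blue-pin atoms, §40.4), and the REDUCTION: if the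
parallel step of the masked family holds on the region (`maskD_all_of_par`), then `(T-AVG)` holds at every tail
point of every pin-free pattern (`tailAvg_all_of_maskPar`) and with it, by `offaxis_of_tailAvg`, the whole
anti-diagonal unimodality of the tails `T(a,j) ≤ T(a−1,j+1)`, `j + 2 ≤ a` (`offaxis_all_of_maskPar`).  Compared with
`Tail2DTailAvg.tailAvg_all_of_par` the open hypothesis is now the parallel step of a LINEAR family.
-/

namespace Summit.Ventures.PercRepro2.Tail2D

open V2Closure

section Mask

/-- flip the free edges selected by a mask (pins and absent edges have one state) -/
def xorConf : ∀ s : SP, s.Conf → s.Conf → s.Conf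
  | .free, x, m => xor x m
  | .pin, x, _ => x
  | .absent, x, _ => x
  | .ser s t, x, m => (xorConf s x.1 m.1, xorConf t x.2 m.2)
  | .par s t, x, m => (xorConf s x.1 m.1, xorConf t x.2 m.2)

/-- flipping the same mask twice is the identity -/
theorem xorConf_xorConf : ∀ (s : SP) (x m : s.Conf), xorConf s (xorConf s x m) m = x
  | .free, x, m => by cases x <;> cases m <;> rfl
  | .pin, _, _ => rfl
  | .absent, _, _ => rfl
  | .ser s t, x, m => by
      obtain ⟨x1, x2⟩ := x
      obtain ⟨m1, m2⟩ := m
      show (xorConf s (xorConf s x1 m1) m1, xorConf t (xorConf t x2 m2) m2) = (x1, x2)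
      rw [xorConf_xorConf s, xorConf_xorConf t]
  | .par s t, x, m => by
      obtain ⟨x1, x2⟩ := x
      obtain ⟨m1, m2⟩ := m
      show (xorConf s (xorConf s x1 m1) m1, xorConf t (xorConf t x2 m2) m2) = (x1, x2)
      rw [xorConf_xorConf s, xorConf_xorConf t]

/-- the mask is recovered from the pair: `x ⊕ (x ⊕ m) = m` -/
theorem xorConf_xorConf_left : ∀ (s : SP) (x m : s.Conf), xorConf s x (xorConf s x m) = m
  | .free, x, m => by cases x <;> cases m <;> rfl
  | .pin, _, _ => rfl
  | .absent, _, _ => rfl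
  | .ser s t, x, m => by
      obtain ⟨x1, x2⟩ := x
      obtain ⟨m1, m2⟩ := m
      show (xorConf s x1 (xorConf s x1 m1), xorConf t x2 (xorConf t x2 m2)) = (m1, m2)
      rw [xorConf_xorConf_left s, xorConf_xorConf_left t]
  | .par s t, x, m => by
      obtain ⟨x1, x2⟩ := x
      obtain ⟨m1, m2⟩ := m
      show (xorConf s x1 (xorConf s x1 m1), xorConf t x2 (xorConf t x2 m2)) = (m1, m2)
      rw [xorConf_xorConf_left s, xorConf_xorConf_left t]

/-- flipping a fixed mask is a bijection of the configurations -/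
def xorEquiv (s : SP) (m : s.Conf) : s.Conf ≃ s.Conf where
  toFun x := xorConf s x m
  invFun x := xorConf s x m
  left_inv x := xorConf_xorConf s x m
  right_inv x := xorConf_xorConf s x m

/-- for a fixed configuration, the mask is a bijection onto the flipped configuration -/
def xorEquivLeft (s : SP) (x : s.Conf) : s.Conf ≃ s.Conf where
  toFun m := xorConf s x m
  invFun y := xorConf s x y
  left_inv m := xorConf_xorConf_left s x m
  right_inv y := xorConf_xorConf_left s x y

/-- the blue-path count of a configuration, as an integer -/
def bp (s : SP) (x : s.Conf) : ℤ := Fintype.card (bluePaths s x)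

/-- the blue-path count is non-negative -/
theorem bp_nonneg (s : SP) (x : s.Conf) : 0 ≤ bp s x := by unfold bp; exact Int.natCast_nonneg _

/-- **the masked antipodal 4-tail sum** `maskD s m α γ α' γ' = Σ_{r ≥ α, b ≥ γ, r̄ ≥ α', b̄ ≥ γ'} (π − π̄)`, where the
barred labels are those of `x ⊕ m` -/
def maskD (s : SP) (m : s.Conf) (α γ α' γ' : ℕ) : ℤ :=
  ∑ x : s.Conf,
    if (α ≤ s.rLab x ∧ γ ≤ s.bLab x) ∧ (α' ≤ s.rLab (xorConf s x m) ∧ γ' ≤ s.bLab (xorConf s x m))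
    then bp s x - bp s (xorConf s x m) else 0

/-- **the masked antipodal form `CC_m(a,c)` of the tail-average monotonicity**: the masked 4-tail sum at the
tail-average position `(a, c | a−1, c+1)` -/
def maskCC (s : SP) (m : s.Conf) (a c : ℕ) : ℤ := maskD s m a c (a - 1) (c + 1)

/-- the masked 4-tail COUNT (the weight of the fibre formula) -/
def maskT (s : SP) (m : s.Conf) (α γ α' γ' : ℕ) : ℤ :=
  ∑ x : s.Conf,
    if (α ≤ s.rLab x ∧ γ ≤ s.bLab x) ∧ (α' ≤ s.rLab (xorConf s x m) ∧ γ' ≤ s.bLab (xorConf s x m))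
    then (1 : ℤ) else 0

/-- the census region of the masked family: the antipodal constraint is strictly less red and its level is not
lower (`α' < α ∧ α + γ ≤ α' + γ'`); the tail-average position `(a, c | a−1, c+1)`, `a ≥ 1`, lies in it -/
def Region (α γ α' γ' : ℕ) : Prop := α' < α ∧ α + γ ≤ α' + γ'

/-- the tail-average position lies in the region -/
theorem region_tailAvg (a c : ℕ) (ha : 1 ≤ a) : Region a c (a - 1) (c + 1) := by
  unfold Region; omega

end Mask

section Reduction

variable (s : SP)

/-- the sum of a product of weights over a product type -/
theorem sum_mul_sum_int {α β : Type} [Fintype α] [Fintype β] (f : α → ℤ) (g : β → ℤ) :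
    (∑ y : α × β, f y.1 * g y.2) = (∑ a : α, f a) * (∑ b : β, g b) := by
  rw [Finset.sum_mul_sum, ← Fintype.sum_prod_type']

/-- **the tail-average defect is the sum of the masked antipodal sums**:
`P(a,c)·T(a−1,c+1) − P(a−1,c+1)·T(a,c) = Σ_m CC_m(a,c)` -/
theorem sum_maskCC (a c : ℕ) :
    (∑ m : s.Conf, maskCC s m a c)
      = (tailPaths s a c : ℤ) * tailCount s (a - 1) (c + 1) - (tailPaths s (a - 1) (c + 1) : ℤ) * tailCount s a c := by
  -- step 1: reindex the inner sum by `y = x ⊕ m`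
  have h1 : (∑ m : s.Conf, maskCC s m a c)
      = ∑ x : s.Conf, ∑ y : s.Conf,
          if (a ≤ s.rLab x ∧ c ≤ s.bLab x) ∧ (a - 1 ≤ s.rLab y ∧ c + 1 ≤ s.bLab y) then bp s x - bp s y else 0 := by
    unfold maskCC maskD
    rw [Finset.sum_comm]
    refine Finset.sum_congr rfl (fun x _ => ?_)
    exact (Equiv.sum_comp (xorEquivLeft s x) (fun y =>
      if (a ≤ s.rLab x ∧ c ≤ s.bLab x) ∧ (a - 1 ≤ s.rLab y ∧ c + 1 ≤ s.bLab y) then bp s x - bp s y else 0))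
  -- step 2: evaluate the double sum
  rw [h1]
  have h2 : (∑ x : s.Conf, ∑ y : s.Conf,
        if (a ≤ s.rLab x ∧ c ≤ s.bLab x) ∧ (a - 1 ≤ s.rLab y ∧ c + 1 ≤ s.bLab y) then bp s x - bp s y else 0)
      = ∑ x ∈ Finset.univ.filter (fun x : s.Conf => a ≤ s.rLab x ∧ c ≤ s.bLab x),
          ∑ y ∈ Finset.univ.filter (fun y : s.Conf => a - 1 ≤ s.rLab y ∧ c + 1 ≤ s.bLab y), (bp s x - bp s y) := by
    rw [Finset.sum_filter]
    refine Finset.sum_congr rfl (fun x _ => ?_)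
    rw [Finset.sum_filter]
    by_cases hx : a ≤ s.rLab x ∧ c ≤ s.bLab x
    · rw [if_pos hx]
      refine Finset.sum_congr rfl (fun y _ => ?_)
      simp only [hx, true_and]
    · rw [if_neg hx]
      simp only [hx, false_and, if_false, Finset.sum_const_zero]
  rw [h2]
  unfold tailPaths tailCount bp
  push_cast
  simp only [Finset.sum_sub_distrib, Finset.sum_const, nsmul_eq_mul, Finset.mul_sum, Finset.sum_mul]
  congr 1 <;> exact Finset.sum_congr rfl (fun x _ => mul_comm _ _)

/-- **(T-AVG) from the masked antipodal sums**: if every `CC_m(a,c) ≤ 0` then `(T-AVG)(a,c)` -/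
theorem tailAvg_of_maskCC (a c : ℕ) (h : ∀ m : s.Conf, maskCC s m a c ≤ 0) : TailAvg s a c := by
  unfold TailAvg
  have hs : (∑ m : s.Conf, maskCC s m a c) ≤ 0 := Finset.sum_nonpos (fun m _ => h m)
  rw [sum_maskCC] at hs
  have := sub_nonpos.1 hs
  exact_mod_cast this

end Reduction

section Structure

/-- **the involution**: swapping the direct and the antipodal constraints negates the masked 4-tail sum -/
theorem maskD_swap (s : SP) (m : s.Conf) (α γ α' γ' : ℕ) : maskD s m α γ α' γ' = - maskD s m α' γ' α γ := by
  unfold maskD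
  rw [← Finset.sum_neg_distrib]
  rw [← Equiv.sum_comp (xorEquiv s m)]
  refine Finset.sum_congr rfl (fun x _ => ?_)
  simp only [xorEquiv, Equiv.coe_fn_mk, xorConf_xorConf]
  by_cases h : (α ≤ s.rLab (xorConf s x m) ∧ γ ≤ s.bLab (xorConf s x m)) ∧ (α' ≤ s.rLab x ∧ γ' ≤ s.bLab x)
  · rw [if_pos h, if_pos ⟨h.2, h.1⟩]; ring
  · rw [if_neg h, if_neg (fun h' => h ⟨h'.2, h'.1⟩)]; ring

/-- the blue-path count of a series pair is the product (integer form) -/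
theorem bp_ser (s t : SP) (p : (SP.ser s t).Conf) : bp (SP.ser s t) p = bp s p.1 * bp t p.2 := by
  unfold bp; rw [card_bluePaths_ser]; push_cast; ring

/-- the blue-path count of a parallel pair is the sum (integer form) -/
theorem bp_par (s t : SP) (p : (SP.par s t).Conf) : bp (SP.par s t) p = bp s p.1 + bp t p.2 := by
  unfold bp
  show ((Fintype.card (bluePaths s p.1 ⊕ bluePaths t p.2) : ℕ) : ℤ) = _
  rw [Fintype.card_sum]; push_cast; ring

/-- the masked 4-tail sum splits as the `π`-mass minus the `π̄`-mass of the masked 4-tail -/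
theorem maskD_eq_sub (s : SP) (m : s.Conf) (α γ α' γ' : ℕ) :
    maskD s m α γ α' γ'
      = (∑ x : s.Conf, if (α ≤ s.rLab x ∧ γ ≤ s.bLab x) ∧ (α' ≤ s.rLab (xorConf s x m) ∧ γ' ≤ s.bLab (xorConf s x m))
            then bp s x else 0)
        - (∑ x : s.Conf, if (α ≤ s.rLab x ∧ γ ≤ s.bLab x) ∧ (α' ≤ s.rLab (xorConf s x m) ∧ γ' ≤ s.bLab (xorConf s x m))
            then bp s (xorConf s x m) else 0) := by
  unfold maskD
  rw [← Finset.sum_sub_distrib]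
  refine Finset.sum_congr rfl (fun x _ => ?_)
  split_ifs <;> ring

/-- the masked 4-tail of a series composition is the product of the factors' masked 4-tails -/
theorem ser_cond_iff (s t : SP) (m : (SP.ser s t).Conf) (α γ α' γ' : ℕ) (x : (SP.ser s t).Conf) :
    ((α ≤ (SP.ser s t).rLab x ∧ γ ≤ (SP.ser s t).bLab x)
        ∧ (α' ≤ (SP.ser s t).rLab (xorConf (SP.ser s t) x m) ∧ γ' ≤ (SP.ser s t).bLab (xorConf (SP.ser s t) x m)))
      ↔ (((α ≤ s.rLab x.1 ∧ γ ≤ s.bLab x.1) ∧ (α' ≤ s.rLab (xorConf s x.1 m.1) ∧ γ' ≤ s.bLab (xorConf s x.1 m.1)))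
        ∧ ((α ≤ t.rLab x.2 ∧ γ ≤ t.bLab x.2) ∧ (α' ≤ t.rLab (xorConf t x.2 m.2) ∧ γ' ≤ t.bLab (xorConf t x.2 m.2)))) := by
  show ((α ≤ serR s.rLab t.rLab x ∧ γ ≤ serB s.bLab t.bLab x)
        ∧ (α' ≤ serR s.rLab t.rLab (xorConf s x.1 m.1, xorConf t x.2 m.2)
            ∧ γ' ≤ serB s.bLab t.bLab (xorConf s x.1 m.1, xorConf t x.2 m.2))) ↔ _
  simp only [serR, serB, le_min_iff]
  tauto

/-- **the series step of the masked family** (any position): both masked 4-tails multiply, so the inequality is the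
product of the factors' inequalities -/
theorem maskD_ser (s t : SP) (m : (SP.ser s t).Conf) (α γ α' γ' : ℕ)
    (hs : maskD s m.1 α γ α' γ' ≤ 0) (ht : maskD t m.2 α γ α' γ' ≤ 0) : maskD (SP.ser s t) m α γ α' γ' ≤ 0 := by
  rw [maskD_eq_sub] at hs ht ⊢
  set A₁ := ∑ x : s.Conf, if (α ≤ s.rLab x ∧ γ ≤ s.bLab x) ∧ (α' ≤ s.rLab (xorConf s x m.1) ∧ γ' ≤ s.bLab (xorConf s x m.1))
      then bp s x else 0 with hA₁
  set B₁ := ∑ x : s.Conf, if (α ≤ s.rLab x ∧ γ ≤ s.bLab x) ∧ (α' ≤ s.rLab (xorConf s x m.1) ∧ γ' ≤ s.bLab (xorConf s x m.1))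
      then bp s (xorConf s x m.1) else 0 with hB₁
  set A₂ := ∑ x : t.Conf, if (α ≤ t.rLab x ∧ γ ≤ t.bLab x) ∧ (α' ≤ t.rLab (xorConf t x m.2) ∧ γ' ≤ t.bLab (xorConf t x m.2))
      then bp t x else 0 with hA₂
  set B₂ := ∑ x : t.Conf, if (α ≤ t.rLab x ∧ γ ≤ t.bLab x) ∧ (α' ≤ t.rLab (xorConf t x m.2) ∧ γ' ≤ t.bLab (xorConf t x m.2))
      then bp t (xorConf t x m.2) else 0 with hB₂
  have eA : (∑ x : (SP.ser s t).Conf,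
      if (α ≤ (SP.ser s t).rLab x ∧ γ ≤ (SP.ser s t).bLab x)
          ∧ (α' ≤ (SP.ser s t).rLab (xorConf (SP.ser s t) x m) ∧ γ' ≤ (SP.ser s t).bLab (xorConf (SP.ser s t) x m))
      then bp (SP.ser s t) x else 0) = A₁ * A₂ := by
    rw [hA₁, hA₂, ← sum_mul_sum_int]
    refine Finset.sum_congr rfl (fun x _ => ?_)
    rw [bp_ser]
    by_cases h : ((α ≤ s.rLab x.1 ∧ γ ≤ s.bLab x.1) ∧ (α' ≤ s.rLab (xorConf s x.1 m.1) ∧ γ' ≤ s.bLab (xorConf s x.1 m.1)))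
        ∧ ((α ≤ t.rLab x.2 ∧ γ ≤ t.bLab x.2) ∧ (α' ≤ t.rLab (xorConf t x.2 m.2) ∧ γ' ≤ t.bLab (xorConf t x.2 m.2)))
    · rw [if_pos ((ser_cond_iff s t m α γ α' γ' x).2 h), if_pos h.1, if_pos h.2]
    · rw [if_neg (fun h' => h ((ser_cond_iff s t m α γ α' γ' x).1 h'))]
      by_cases h1 : (α ≤ s.rLab x.1 ∧ γ ≤ s.bLab x.1) ∧ (α' ≤ s.rLab (xorConf s x.1 m.1) ∧ γ' ≤ s.bLab (xorConf s x.1 m.1))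
      · rw [if_pos h1, if_neg (fun h2 => h ⟨h1, h2⟩), mul_zero]
      · rw [if_neg h1, zero_mul]
  have eB : (∑ x : (SP.ser s t).Conf,
      if (α ≤ (SP.ser s t).rLab x ∧ γ ≤ (SP.ser s t).bLab x)
          ∧ (α' ≤ (SP.ser s t).rLab (xorConf (SP.ser s t) x m) ∧ γ' ≤ (SP.ser s t).bLab (xorConf (SP.ser s t) x m))
      then bp (SP.ser s t) (xorConf (SP.ser s t) x m) else 0) = B₁ * B₂ := by
    rw [hB₁, hB₂, ← sum_mul_sum_int]
    refine Finset.sum_congr rfl (fun x _ => ?_)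
    have e : bp (SP.ser s t) (xorConf (SP.ser s t) x m) = bp s (xorConf s x.1 m.1) * bp t (xorConf t x.2 m.2) := by
      show bp (SP.ser s t) (xorConf s x.1 m.1, xorConf t x.2 m.2) = _
      rw [bp_ser]
    rw [e]
    by_cases h : ((α ≤ s.rLab x.1 ∧ γ ≤ s.bLab x.1) ∧ (α' ≤ s.rLab (xorConf s x.1 m.1) ∧ γ' ≤ s.bLab (xorConf s x.1 m.1)))
        ∧ ((α ≤ t.rLab x.2 ∧ γ ≤ t.bLab x.2) ∧ (α' ≤ t.rLab (xorConf t x.2 m.2) ∧ γ' ≤ t.bLab (xorConf t x.2 m.2)))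
    · rw [if_pos ((ser_cond_iff s t m α γ α' γ' x).2 h), if_pos h.1, if_pos h.2]
    · rw [if_neg (fun h' => h ((ser_cond_iff s t m α γ α' γ' x).1 h'))]
      by_cases h1 : (α ≤ s.rLab x.1 ∧ γ ≤ s.bLab x.1) ∧ (α' ≤ s.rLab (xorConf s x.1 m.1) ∧ γ' ≤ s.bLab (xorConf s x.1 m.1))
      · rw [if_pos h1, if_neg (fun h2 => h ⟨h1, h2⟩), mul_zero]
      · rw [if_neg h1, zero_mul]
  rw [eA, eB]
  have hA₁0 : 0 ≤ A₁ := Finset.sum_nonneg (fun x _ => by split_ifs; exacts [bp_nonneg s x, le_rfl])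
  have hA₂0 : 0 ≤ A₂ := Finset.sum_nonneg (fun x _ => by split_ifs; exacts [bp_nonneg t x, le_rfl])
  have hB₂0 : 0 ≤ B₂ := Finset.sum_nonneg (fun x _ => by split_ifs; exacts [bp_nonneg t _, le_rfl])
  have h1 : A₁ ≤ B₁ := sub_nonpos.1 hs
  have h2 : A₂ ≤ B₂ := sub_nonpos.1 ht
  have : A₁ * A₂ ≤ B₁ * B₂ := mul_le_mul h1 h2 hA₂0 (le_trans hA₁0 h1)
  exact sub_nonpos.2 this

/-- the parallel condition fibres: `α ≤ r₁ + r₂ ↔ α − r₂ ≤ r₁` (truncated subtraction = «no constraint») -/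
theorem par_cond_iff (s t : SP) (m : (SP.par s t).Conf) (α γ α' γ' : ℕ) (x : (SP.par s t).Conf) :
    ((α ≤ (SP.par s t).rLab x ∧ γ ≤ (SP.par s t).bLab x)
        ∧ (α' ≤ (SP.par s t).rLab (xorConf (SP.par s t) x m) ∧ γ' ≤ (SP.par s t).bLab (xorConf (SP.par s t) x m)))
      ↔ ((α - t.rLab x.2 ≤ s.rLab x.1 ∧ γ - t.bLab x.2 ≤ s.bLab x.1)
          ∧ (α' - t.rLab (xorConf t x.2 m.2) ≤ s.rLab (xorConf s x.1 m.1)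
              ∧ γ' - t.bLab (xorConf t x.2 m.2) ≤ s.bLab (xorConf s x.1 m.1))) := by
  show ((α ≤ parR s.rLab t.rLab x ∧ γ ≤ parB s.bLab t.bLab x)
        ∧ (α' ≤ parR s.rLab t.rLab (xorConf s x.1 m.1, xorConf t x.2 m.2)
            ∧ γ' ≤ parB s.bLab t.bLab (xorConf s x.1 m.1, xorConf t x.2 m.2))) ↔ _
  simp only [parR, parB]
  omega

/-- **the parallel fibre formula**: the masked 4-tail sum of `s ∥ t` is the sum over the configurations `y` of `t`
of the masked 4-tail sum of `s` at the shifted position plus `(π_y − π_ȳ)` times the masked 4-tail count of `s` there -/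
theorem maskD_par (s t : SP) (m : (SP.par s t).Conf) (α γ α' γ' : ℕ) :
    maskD (SP.par s t) m α γ α' γ'
      = ∑ y : t.Conf,
          (maskD s m.1 (α - t.rLab y) (γ - t.bLab y) (α' - t.rLab (xorConf t y m.2)) (γ' - t.bLab (xorConf t y m.2))
            + (bp t y - bp t (xorConf t y m.2))
              * maskT s m.1 (α - t.rLab y) (γ - t.bLab y) (α' - t.rLab (xorConf t y m.2)) (γ' - t.bLab (xorConf t y m.2))) := by
  unfold maskD maskT
  simp only [Finset.mul_sum, ← Finset.sum_add_distrib]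
  rw [Finset.sum_comm, ← Fintype.sum_prod_type']
  refine Finset.sum_congr rfl (fun p _ => ?_)
  obtain ⟨x, y⟩ := p
  have e : bp (SP.par s t) (xorConf (SP.par s t) (x, y) m) = bp s (xorConf s x m.1) + bp t (xorConf t y m.2) := by
    show bp (SP.par s t) (xorConf s x m.1, xorConf t y m.2) = _
    rw [bp_par]
  rw [bp_par, e]
  by_cases h : (α - t.rLab y ≤ s.rLab x ∧ γ - t.bLab y ≤ s.bLab x)
      ∧ (α' - t.rLab (xorConf t y m.2) ≤ s.rLab (xorConf s x m.1) ∧ γ' - t.bLab (xorConf t y m.2) ≤ s.bLab (xorConf s x m.1))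
  · rw [if_pos ((par_cond_iff s t m α γ α' γ' (x, y)).2 h), if_pos h, if_pos h]; ring
  · rw [if_neg (fun h' => h ((par_cond_iff s t m α γ α' γ' (x, y)).1 h')), if_neg h, if_neg h]; ring

end Structure

section Atoms

/-- the blue-path count of a free edge: one path when blue, none when red -/
theorem bp_free (c : Bool) : bp SP.free c = if c then 1 else 0 := by
  cases c <;> rfl

/-- the free edge on the region: the only negative-signed pair is `(red, blue)`, the other order needs `α = 0` -/
theorem maskD_free (m : SP.free.Conf) (α γ α' γ' : ℕ) (hR : Region α γ α' γ') : maskD SP.free m α γ α' γ' ≤ 0 := by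
  unfold Region at hR
  unfold maskD
  refine (Fintype.sum_bool _).trans_le ?_
  cases m <;> simp only [xorConf, Bool.xor_false, Bool.xor_true, Bool.not_true, Bool.not_false, SP.rLab, SP.bLab,
    bp_free] <;> simp only [if_true, if_false, Bool.false_eq_true] <;> split_ifs <;> omega

/-- the absent edge carries no path: the masked sum vanishes -/
theorem maskD_absent (m : SP.absent.Conf) (α γ α' γ' : ℕ) : maskD SP.absent m α γ α' γ' ≤ 0 := by
  unfold maskD
  apply Finset.sum_nonpos
  intro x _
  split_ifs
  · simp only [bp, bluePaths]; simp
  · exact le_rfl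

end Atoms

section AllOfPar

/-- **the reduction**: the masked family on the region holds on every pin-free pattern as soon as its PARALLEL step
does (atoms: `maskD_free`, `maskD_absent`; series: `maskD_ser`) -/
theorem maskD_all_of_par
    (hpar : ∀ s t : SP, PinFree s → PinFree t →
      (∀ (m : s.Conf) (α γ α' γ' : ℕ), Region α γ α' γ' → maskD s m α γ α' γ' ≤ 0) →
      (∀ (m : t.Conf) (α γ α' γ' : ℕ), Region α γ α' γ' → maskD t m α γ α' γ' ≤ 0) →
      ∀ (m : (SP.par s t).Conf) (α γ α' γ' : ℕ), Region α γ α' γ' → maskD (SP.par s t) m α γ α' γ' ≤ 0) :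
    ∀ {s : SP}, PinFree s → ∀ (m : s.Conf) (α γ α' γ' : ℕ), Region α γ α' γ' → maskD s m α γ α' γ' ≤ 0
  | .free, _, m, α, γ, α', γ', hR => maskD_free m α γ α' γ' hR
  | .absent, _, m, α, γ, α', γ', _ => maskD_absent m α γ α' γ'
  | .ser s t, .ser hs ht, m, α, γ, α', γ', hR =>
      maskD_ser s t m α γ α' γ' (maskD_all_of_par hpar hs m.1 α γ α' γ' hR) (maskD_all_of_par hpar ht m.2 α γ α' γ' hR)
  | .par s t, .par hs ht, m, α, γ, α', γ', hR =>
      hpar s t hs ht (fun m' α' γ' α'' γ'' h' => maskD_all_of_par hpar hs m' α' γ' α'' γ'' h')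
        (fun m' α' γ' α'' γ'' h' => maskD_all_of_par hpar ht m' α' γ' α'' γ'' h') m α γ α' γ' hR

/-- **(T-AVG) at every tail point of every pin-free pattern, under the parallel step of the masked family** -/
theorem tailAvg_all_of_maskPar
    (hpar : ∀ s t : SP, PinFree s → PinFree t →
      (∀ (m : s.Conf) (α γ α' γ' : ℕ), Region α γ α' γ' → maskD s m α γ α' γ' ≤ 0) →
      (∀ (m : t.Conf) (α γ α' γ' : ℕ), Region α γ α' γ' → maskD t m α γ α' γ' ≤ 0) →
      ∀ (m : (SP.par s t).Conf) (α γ α' γ' : ℕ), Region α γ α' γ' → maskD (SP.par s t) m α γ α' γ' ≤ 0)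
    {s : SP} (hs : PinFree s) (a c : ℕ) (ha : 1 ≤ a) : TailAvg s a c :=
  tailAvg_of_maskCC s a c (fun m => maskD_all_of_par hpar hs m a c (a - 1) (c + 1) (region_tailAvg a c ha))

/-- **the whole anti-diagonal unimodality of the tails on every pin-free pattern, under the parallel step of the
masked (linear) family**: `T(a,j) ≤ T(a−1,j+1)` for `j + 2 ≤ a` -/
theorem offaxis_all_of_maskPar
    (hpar : ∀ s t : SP, PinFree s → PinFree t →
      (∀ (m : s.Conf) (α γ α' γ' : ℕ), Region α γ α' γ' → maskD s m α γ α' γ' ≤ 0) →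
      (∀ (m : t.Conf) (α γ α' γ' : ℕ), Region α γ α' γ' → maskD t m α γ α' γ' ≤ 0) →
      ∀ (m : (SP.par s t).Conf) (α γ α' γ' : ℕ), Region α γ α' γ' → maskD (SP.par s t) m α γ α' γ' ≤ 0)
    {s : SP} (hs : PinFree s) (a j : ℕ) (hja : j + 2 ≤ a) :
    (Finset.univ.filter (fun x : s.Conf => a ≤ s.rLab x ∧ j ≤ s.bLab x)).card
      ≤ (Finset.univ.filter (fun x : s.Conf => a - 1 ≤ s.rLab x ∧ j + 1 ≤ s.bLab x)).card := by
  have h := offaxis_of_tailAvg hs (fun a' c' h' => tailAvg_all_of_maskPar hpar hs a' c' h') j a (by omega)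
  unfold tailCount at h
  rw [tail_symm s a j, tail_symm s (a - 1) (j + 1)]
  exact h

end AllOfPar

end Summit.Ventures.PercRepro2.Tail2D
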